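import Summits.QuantumFields.YangMills.Theorems.PoincareLipschitzTangentMapConstantOfGap
import Summits.QuantumFields.YangMills.Theorems.PoincareLipschitzGapOfHSystemGap
import Summits.QuantumFields.YangMills.Theorems.PoincareLipschitzHSystemGapAtThreePiOfDoors
import Summits.QuantumFields.YangMills.Theorems.PoincareLipschitzWenteTwoPointOfRows
import Summits.QuantumFields.YangMills.Theorems.PoincareLipschitzWenteOneCentre
import Summits.QuantumFields.YangMills.Theorems.PoincareLipschitzSobolevInversionWente
import Summits.QuantumFields.YangMills.Theorems.PoincareLipschitzSobolevPlanarDecay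
import HarnessLib

/-!
# Crux `BlockLipschitzL` (stmt-QuantumFields-23533) ∕ `HistoryTailL` (stmt-QuantumFields-19936), LINE 25 «CompactnessTransfer» —
# FILE TM-HOLDS «SCHOEN–UHLENBECK's PROPOSITION 1.2 IS A THEOREM OF THE TREE»

Cell `ym3-torus` (YM ladder rung R3 = continuum SU(2) Yang–Mills on T³ — a RUNG, NOT Clay: not d = 4, not infinite volume,
not a mass gap); WIDTH helper seat `ym3-torus-px16` g10; `--supports stmt-QuantumFields-23533`; THEOREMS ONLY (0 `def`, 0 `sorry`,
default heartbeats); imports this seat's ✓`…TangentMapConstantOfGap` (★★★ `minimisingTangentMapConstant_of_gap`: (GAP) ⟹ (TM)) and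
px19 g8's ✓`…GapOfHSystemGap` (★★★ `gap_of_hSystemGap (hF′)`: the `8π`-gap row from the `3π` H-system gap, over ROAD (H) — SU(2)
currents ⇒ H-system, the cone chart, planar stream functions) and ROAD (W)'s hypothesis-free `3π` H-system gap — ★w3 g16's ✓`…HSystemGapAtThreePi.hSystem_energy_zero_of_le_three_pi`, whose TERM
over the older ACCEPTED modules (✓`…OfDoors.hSystem_energy_zero_of_le_three_pi_of_doorTWO`, px22's ✓`…WenteTwoPointOfRows.doorTWO_of_rows`,
w7's ✓`…WenteOneCentre.wente_oneCentre`, w4's ✓`…SobolevInversion.wenteTriple_comp_inversion`, px22's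
✓`…SobolevPlanarDecay.integrableOn_sq_div_norm_pow_four`) is INLINED here VERBATIM (as LEAD ★w1-19936 g10 did for the 23533 close,
D-0071: the named modules `…HSystemGapAtThreePi` ∕ px19's (W2) `…GapHolds.gap_holds` wait on the farm's olean queue, not on
mathematics; they are interchangeable with this term by `rfl` of proofs).

WHAT THIS FILE PROVES.  ★★★★ `minimisingTangentMapConstant_holds : Literature.Analysis.PDE.MinimisingTangentMapConstant` — the
Literature NAMED FACT [SchoenUhlenbeck1984, Proposition 1.2] «a minimizing tangent map `ℝ³ → S³` is constant», read on the open unit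
cube (a finite-energy unit `W^{1,2}` ball-minimiser `Q → S³ ⊂ ℝ⁴` with `G x x = 0` a.e. has `G = 0` a.e.), is DISCHARGED: it is now a
hypothesis-free theorem of the tree (Summits-side, as ✓`…MinimisingMapCompactnessHolds.minimisingMapCompactness_holds` discharged (C);
a Literature file cannot import the Summits-side proof).  The printed proof's inputs — [SchoenUhlenbeck1982] partial regularity,
dimension reduction, Lemma 1.1's `8π` quantisation via the classification of harmonic 2-spheres — are NOT used: the tree's proof is
stability + Hardy `¼` (`Θ ≤ 3π`, px3), homogeneity (px14), the conformal cone chart (px16∕px14), SU(2) left currents ⇒ a finite-energy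
weak H-system on `ℝ²` (px19), planar stream functions (px5), and the H-system energy gap `Θ ≤ 3π ⇒ Θ = 0` from the sharp two-point
Wente inequality with equality case (★w3, w7, w4, px22, px6, px3 g10).

HONEST SCOPE.  A one-line composition; the mathematics is in the files named above.  Consumers: every face still carrying
`(hT : MinimisingTangentMapConstant)` (LEAD K-13 ∕ K-14, ★w3 g15's one-fact door) can now pass `minimisingTangentMapConstant_holds`.
S1″ ∕ `BlockLipschitzL` close through LEAD's (GAP) face, not through this file; K1, `MeanDeviationL`, `HistoryTailL` NOT proved here.
YM₃ on T³ is rung R3, not Clay; YM gap NOT proved; no summit statement is proved here.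

References: R. Schoen, K. Uhlenbeck, Invent. Math. 78 (1984) 89–100 [SchoenUhlenbeck1984] (Prop. 1.2); H. Brezis, J.-M. Coron,
Arch. Rational Mech. Anal. 89 (1985) [BrezisCoron1985] (Lemma A.1, the road not needed any more); P. Topping, Comment. Math. Helv. 72
(1997) (the optimal constant in Wente's `L^∞` estimate).
-/

set_option autoImplicit false

noncomputable section

namespace Summit.QuantumFields.YangMills.Theorems.PoincareLipschitzMinimisingTangentMapConstantHolds

open Summit.QuantumFields.YangMills.Theorems.PoincareLipschitzTangentMapConstantOfGap (minimisingTangentMapConstant_of_gap)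
open Summit.QuantumFields.YangMills.Theorems
open Summit.QuantumFields.YangMills.Theorems.PoincareLipschitzGapOfHSystemGap (gap_of_hSystemGap)

/-- ★★★★ **SCHOEN–UHLENBECK's PROPOSITION 1.2 — «MINIMIZING TANGENT MAPS `ℝ³ → S³` ARE CONSTANT» — HOLDS**: the Literature named fact
`Literature.Analysis.PDE.MinimisingTangentMapConstant` is a hypothesis-free theorem of the tree (the `8π`-gap row — px19 g8's
`gap_of_hSystemGap` fed with ROAD (W)'s `3π` gap term = ★w3 g16's `hSystem_energy_zero_of_le_three_pi` ∕ px19's (W2) `gap_holds`,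
inlined over accepted modules — through the bridge ✓`minimisingTangentMapConstant_of_gap`). [cite: SchoenUhlenbeck1984, Proposition 1.2 (p. 90)] -/
theorem minimisingTangentMapConstant_holds : Literature.Analysis.PDE.MinimisingTangentMapConstant :=
  minimisingTangentMapConstant_of_gap
    (gap_of_hSystemGap fun _ _ hB hB2 hE hH hΘ =>
      PoincareLipschitzHSystemGapAtThreePiOfDoors.hSystem_energy_zero_of_le_three_pi_of_doorTWO
        (PoincareLipschitzWenteTwoPointOfRows.doorTWO_of_rows
          PoincareLipschitzWenteOneCentre.wente_oneCentre
          (fun c _ _ _ _ _ _ hu ha hb hu2 ha2 hb2 hGu hGa hGb hEq hdu hda hdb =>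
            PoincareLipschitzSobolevInversion.wenteTriple_comp_inversion c hu ha hb hu2 ha2 hb2 hGu hGa hGb hEq hdu hda hdb)
          (fun hv hv2 hGv c => PoincareLipschitzSobolevPlanarDecay.integrableOn_sq_div_norm_pow_four hv hv2 hGv c))
        hB hB2 hE hH hΘ)

end Summit.QuantumFields.YangMills.Theorems.PoincareLipschitzMinimisingTangentMapConstantHolds

end
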